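import Literature.NumberTheory.GaloisRepresentations.LocalCorInjective
import Literature.NumberTheory.GaloisRepresentations.TateDualityCounting
import HarnessLib

/-!
# Local duality: descent of left non-degeneracy from `Gal(F̄/E)` to `Γ_F` (`p ∤ [E:F]`)

Serre's reduction step in the proof of local Tate duality (*Galois Cohomology*, II §5.2,
Thm. 2): for a finite `p`-power-torsion discrete `Γ_F`-module `M` (`F` a non-archimedean local field
of characteristic `0`) and a finite `E ⊆ F̄` with `p ∤ (Γ_F : Gal(F̄/E))`, **if the left adjoint
`x ↦ ι_E(x ∪ ·)` of the duality pairing `H¹(E, M) × H¹(E, M^D) → ℤ/n` is injective, so is the left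
adjoint of `H¹(F, M) × H¹(F, M^D) → ℤ/n`** (`dualityPairing_injective_of_galFixing`): for `a` in
the left kernel over `F`, `c = res a ∪ b` has `cor c = a ∪ cor b` (projection formula,
`cor_cupProduct_resH`) in the kernel of the injective `ι_F`, so `c = 0` (`cor` is injective on
`p`-primary classes of `H²(E, μ_n)`, `eq_zero_of_cor_two_mu_eq_zero`); hence `res a` is in the left
kernel over `E`, `res a = 0`, and `(Γ_F : Gal(F̄/E)) a = cor (res a) = 0` with `p^k a = 0` gives
`a = 0`.

Also: the open subgroup of index prime to `p` through which a finite module is acted on by a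
`p`-group (`exists_subgroup_index_coprime_isPGroup`, a Sylow subgroup of the finite image),
`μ_n(F̄) ≃ ℤ/n` (`muEquivZMod`) and an injective `ι_F : H²(Γ_F, μ_n) → ℤ/n`
(`exists_injective_iota_top`).

## References
* J.-P. Serre, *Galois Cohomology*, Springer, 1997, II §5.2 (proof of Thm. 2), I §2.4. [SerreGaloisCohomology1997]
* J. S. Milne, *Arithmetic Duality Theorems*, 2006, I §2 (Cor. 2.3). [MilneADT2006]
-/

noncomputable section

open CategoryTheory Function
open Field IsNonarchimedeanLocalField ValuativeRel IntermediateField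

universe u

namespace Literature.NumberTheory.GaloisRepresentations

open _root_.TopRep _root_.ContRepresentation _root_.ContinuousCohomology DiscreteGaloisModule
open LocalWeilDatum

/-! ### Small algebraic helpers -/

section Helpers

/-- A finite `p`-primary group is killed by a fixed power of `p`. [folklore] -/
theorem exists_pow_nsmul_eq_zero_of_isPrimaryTorsion {p : ℕ} {M : Type*} [AddCommGroup M] [Finite M]
    (h : IsPrimaryTorsion p M) : ∃ k : ℕ, ∀ m : M, p ^ k • m = 0 := by
  classical
  haveI := Fintype.ofFinite M
  choose r hr using h
  refine ⟨Finset.univ.sup r, fun m => ?_⟩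
  obtain ⟨j, hj⟩ := Nat.exists_eq_add_of_le (Finset.le_sup (f := r) (Finset.mem_univ m))
  rw [hj, pow_add, mul_nsmul, hr, nsmul_zero]

/-- `d • a = 0`, `p^k • a = 0`, `p ∤ d` ⇒ `a = 0` (Bezout). [folklore] -/
theorem eq_zero_of_nsmul_of_pow_nsmul {A : Type*} [AddCommGroup A] {p d k : ℕ} (hp : p.Prime) (hpd : ¬p ∣ d)
    {a : A} (hd : d • a = 0) (hk : p ^ k • a = 0) : a = 0 := by
  have hcop : Nat.Coprime d (p ^ k) := (Nat.Coprime.pow_right k ((Nat.Prime.coprime_iff_not_dvd hp).2 hpd).symm)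
  obtain ⟨u, v, huv⟩ := Nat.isCoprime_iff_coprime.2 hcop
  have h1 : ((u * d + v * (p ^ k : ℕ) : ℤ)) • a = a := by
    rw [show (u * (d : ℤ) + v * ((p ^ k : ℕ) : ℤ)) = 1 from huv, one_zsmul]
  rw [← h1, add_zsmul, mul_zsmul, mul_zsmul, natCast_zsmul, natCast_zsmul, hd, hk, zsmul_zero, zsmul_zero,
    add_zero]

end Helpers

/-! ### The open subgroup of index prime to `p` with `p`-group action -/

section Sylow

variable {G : Type u} [Group G] [TopologicalSpace G] [IsTopologicalGroup G] [CompactSpace G]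
variable {M : Type u} [AddCommGroup M] [TopologicalSpace M] [DiscreteTopology M] [Finite M]
variable (ρ : ContinuousRep G ℤ M)

omit [IsTopologicalGroup G] [CompactSpace G] in
/-- The kernel of the action on a finite discrete module is open. [folklore] -/
theorem isOpen_ker_toRepresentation : IsOpen ((ρ.toRepresentation.ker : Subgroup G) : Set G) := by
  classical
  haveI := Fintype.ofFinite M
  have h : ((ρ.toRepresentation.ker : Subgroup G) : Set G) = ⋂ m : M, {g | ρ g m = m} := by
    ext g
    simp only [SetLike.mem_coe, MonoidHom.mem_ker, Set.mem_iInter, Set.mem_setOf_eq]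
    constructor
    · intro hg m
      have := LinearMap.congr_fun hg m
      exact this
    · intro hg
      exact LinearMap.ext hg
  rw [h]
  exact isOpen_iInter_of_finite fun m =>
    (isOpen_discrete ({m} : Set M)).preimage (ρ.continuous_apply_left m)

/-- **An open subgroup `S` of index prime to `p` such that `S` acts on the finite module `M` through
a finite `p`-group** `S/N₀` (the preimage of a Sylow `p`-subgroup of the finite image of `G`).
[cite: SerreGaloisCohomology1997, II §5.2 (proof of Thm. 2)] -/
theorem exists_subgroup_index_coprime_isPGroup (p : ℕ) [hp : Fact p.Prime] :
    ∃ S : Subgroup G, IsOpen (S : Set G) ∧ ¬p ∣ S.index ∧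
      ∃ (N₀ : Subgroup S) (_ : N₀.Normal), Finite (S ⧸ N₀) ∧ IsPGroup p (S ⧸ N₀) ∧
        ∀ g ∈ N₀, ∀ m : M, ρ (g : G) m = m := by
  classical
  let N₁ : Subgroup G := ρ.toRepresentation.ker
  have hN₁open : IsOpen (N₁ : Set G) := isOpen_ker_toRepresentation ρ
  haveI : N₁.Normal := MonoidHom.normal_ker _
  haveI : Finite (G ⧸ N₁) := Subgroup.quotient_finite_of_isOpen N₁ hN₁open
  let P : Sylow p (G ⧸ N₁) := default
  let S : Subgroup G := (P : Subgroup (G ⧸ N₁)).comap (QuotientGroup.mk' N₁)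
  have hN₁S : N₁ ≤ S := by
    intro g hg
    change QuotientGroup.mk' N₁ g ∈ (P : Subgroup (G ⧸ N₁))
    rw [QuotientGroup.mk'_apply, (QuotientGroup.eq_one_iff g).2 hg]
    exact one_mem _
  have hSopen : IsOpen (S : Set G) := Subgroup.isOpen_mono hN₁S hN₁open
  have hSidx : S.index = (P : Subgroup (G ⧸ N₁)).index :=
    Subgroup.index_comap_of_surjective (P : Subgroup (G ⧸ N₁)) (QuotientGroup.mk'_surjective N₁)
  haveI : CompactSpace S := isCompact_iff_compactSpace.mp (Subgroup.isClosed_of_isOpen S hSopen).isCompact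
  refine ⟨S, hSopen, ?_, N₁.subgroupOf S, (inferInstance : N₁.Normal).subgroupOf S, ?_, ?_, ?_⟩
  · rw [hSidx]
    exact P.not_dvd_index
  · exact Subgroup.quotient_finite_of_isOpen _
      ((hN₁open.preimage continuous_subtype_val : IsOpen ((N₁.subgroupOf S : Subgroup S) : Set S)))
  · -- `S / N₁ ↪ P`
    let φ : S ⧸ N₁.subgroupOf S →* (P : Subgroup (G ⧸ N₁)) :=
      QuotientGroup.lift (N₁.subgroupOf S)
        (((QuotientGroup.mk' N₁).comp S.subtype).codRestrict (P : Subgroup (G ⧸ N₁)) fun s => s.2)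
        (by
          intro s hs
          apply Subtype.ext
          change QuotientGroup.mk' N₁ (s : G) = 1
          exact (QuotientGroup.eq_one_iff _).2 hs)
    have hφ : Injective φ := by
      refine (injective_iff_map_eq_one φ).2 fun x hx => ?_
      obtain ⟨s, rfl⟩ := QuotientGroup.mk_surjective x
      have hs : ((s : G) : G ⧸ N₁) = 1 := congrArg Subtype.val hx
      exact (QuotientGroup.eq_one_iff s).2 ((QuotientGroup.eq_one_iff (s : G)).1 hs)
    exact P.isPGroup'.of_injective φ hφ
  · intro g hg m
    have h : ρ.toRepresentation (g : G) = 1 := hg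
    exact LinearMap.congr_fun h m

end Sylow

/-! ### `μ_n(F̄) ≃ ℤ/n` and `ι_F : H²(Γ_F, μ_n) ↪ ℤ/n` -/

section Mu

variable (F : Type u) [Field F] [CharZero F]

/-- **`μ_n(F̄) ≃ ℤ/n`** for a field `F` of characteristic `0` (`F̄` has all `n`-th roots of unity,
which form a cyclic group of order `n`). [folklore] -/
def muEquivZMod (n : ℕ) [NeZero n] : MuCarrier F n ≃+ ZMod n := by
  haveI : NeZero (n : F) := ⟨Nat.cast_ne_zero.2 (NeZero.ne n)⟩
  haveI : IsAddCyclic (MuCarrier F n) :=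
    inferInstanceAs (IsAddCyclic (Additive (rootsOfUnity n (AlgebraicClosure F))))
  have hcard : Nat.card (MuCarrier F n) = n := HasEnoughRootsOfUnity.natCard_rootsOfUnity (AlgebraicClosure F) n
  exact ((zmodAddCyclicAddEquiv (G := MuCarrier F n) inferInstance).symm).trans
    (ZMod.ringEquivCongr hcard).toAddEquiv

variable [ValuativeRel F] [TopologicalSpace F] [IsNonarchimedeanLocalField F]

/-- **An injective `ι_F : H²(Γ_F, μ_n) → ℤ/n`** (from `exists_injective_iota` at `E = F` and
`Gal(F̄/F) = Γ_F`, `resHEquivOfTop`).  For the local field `F` this is (an embedding refining) the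
invariant map `inv_F : Br(F)[n] ≅ ℤ/n`. [cite: SerreLocalFields1979, XIII §3; SerreGaloisCohomology1997, II §5.2 Lemme 2] -/
theorem exists_injective_iota_top (n : ℕ) [NeZero n] :
    ∃ ι : continuousCohomology 2 (mu F n).toTopRep →+ ZMod n, Injective ι := by
  have hbot : ∀ g : absoluteGaloisGroup F, g ∈ galFixing F (⊥ : IntermediateField F (AlgebraicClosure F)) :=
    fun g => by rw [galFixing_bot]; trivial
  obtain ⟨ι, hι⟩ := exists_injective_iota F (⊥ : IntermediateField F (AlgebraicClosure F)) n
  let eT := resHEquivOfTop (mu F n) (galFixing F (⊥ : IntermediateField F (AlgebraicClosure F))) hbot 2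
  exact ⟨ι.comp eT.toAddMonoidHom, hι.comp eT.injective⟩

end Mu

/-! ### The descent -/

section Descent

variable {G : Type u} [Group G] [TopologicalSpace G] [IsTopologicalGroup G]
variable {M Ω : Type u} [AddCommGroup M] [TopologicalSpace M] [DiscreteTopology M] [Finite M]
  [AddCommGroup Ω] [TopologicalSpace Ω] [DiscreteTopology Ω]
variable (ρ : ContinuousRep G ℤ M) (ω : ContinuousRep G ℤ Ω)

/-- `Hom(M, Ω)|_H ≅ Hom(M|_H, Ω|_H)` (the identity; `ContinuousRep.homRep_restrict`). [folklore] -/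
def homRepRestrictIso {H : Type u} [Group H] [TopologicalSpace H] [IsTopologicalGroup H] (θ : H →ₜ* G) :
    ((ρ.homRep ω).restrict θ).toTopRep ≅ ((ρ.restrict θ).homRep (ω.restrict θ)).toTopRep :=
  topRepIsoOfEquiv (X := ((ρ.homRep ω).restrict θ).toTopRep) (Y := ((ρ.restrict θ).homRep (ω.restrict θ)).toTopRep)
    (ContinuousLinearEquiv.refl ℤ _) fun g f => by
      change ((ρ.homRep ω).restrict θ) g f = ((ρ.restrict θ).homRep (ω.restrict θ)) g f
      rw [ContinuousRep.homRep_restrict]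

end Descent

section Local

variable (F : Type u) [Field F] [ValuativeRel F] [TopologicalSpace F] [IsNonarchimedeanLocalField F]
  [CharZero F]
variable (E : IntermediateField F (AlgebraicClosure F)) [FiniteDimensional F E]
variable {M : Type u} [AddCommGroup M] [TopologicalSpace M] [DiscreteTopology M] [Finite M]

attribute [local instance] compactSpace_of_isClosed_subgroup isClosed_galFixing' finite_quot_galFixing Fintype.ofFinite

/-- **Descent of left non-degeneracy from `Gal(F̄/E)` to `Γ_F`** (`p ∤ (Γ_F : Gal(F̄/E))`, `M` killed
by `p^k`): see the module docstring. [cite: SerreGaloisCohomology1997, II §5.2 (proof of Thm. 2)] -/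
theorem dualityPairing_injective_of_galFixing {p : ℕ} [hp : Fact p.Prime] (hpd : ¬p ∣ (galFixing F E).index)
    {n : ℕ} [NeZero n] (ιF : continuousCohomology 2 (mu F n).toTopRep →+ ZMod n) (hιF : Injective ιF)
    (ιE : continuousCohomology 2 ((mu F n).restrict (subgroupIncl (galFixing F E))).toTopRep →+ ZMod n)
    (ρ : ContinuousRep (absoluteGaloisGroup F) ℤ M) {k : ℕ} (hk : ∀ m : M, p ^ k • m = 0)
    (hE : Injective ((ρ.restrict (subgroupIncl (galFixing F E))).dualityPairing
      ((mu F n).restrict (subgroupIncl (galFixing F E))) ιE)) :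
    Injective (ρ.dualityPairing (mu F n) ιF) := by
  classical
  refine (injective_iff_map_eq_zero _).2 fun a ha => ?_
  have hka : p ^ k • a = 0 := nsmul_continuousCohomology_one_eq_zero _ _ hk a
  -- (ii) `res a` is in the left kernel over `E`
  have hres0 : (ρ.restrict (subgroupIncl (galFixing F E))).dualityPairing
      ((mu F n).restrict (subgroupIncl (galFixing F E))) ιE (resH (galFixing F E) ρ 1 a) = 0 := by
    refine AddMonoidHom.ext fun b => ?_
    rw [ContinuousRep.dualityPairing_apply, AddMonoidHom.zero_apply]
    let eAB := homRepRestrictIso ρ (mu F n) (subgroupIncl (galFixing F E))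
    let bA := cohomologyMap eAB.inv 1 b
    have hbA : cohomologyMap eAB.hom 1 bA = b := cohomologyMap_inv_hom_apply eAB.symm 1 b
    have hcup : ((ρ.restrict (subgroupIncl (galFixing F E))).evalPairing
        ((mu F n).restrict (subgroupIncl (galFixing F E)))).cupProduct (resH (galFixing F E) ρ 1 a) b =
        cohomologyMap (𝟙 ((mu F n).restrict (subgroupIncl (galFixing F E))).toTopRep) 2
          ((resPairing (galFixing F E) ρ (ρ.homRep (mu F n)) (mu F n) (ρ.evalPairing (mu F n))).cupProduct
            (resH (galFixing F E) ρ 1 a) bA) := by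
      rw [ContPairing.cupProduct_map (resPairing (galFixing F E) ρ (ρ.homRep (mu F n)) (mu F n) (ρ.evalPairing (mu F n)))
        ((ρ.restrict (subgroupIncl (galFixing F E))).evalPairing ((mu F n).restrict (subgroupIncl (galFixing F E))))
        (𝟙 _) eAB.hom (𝟙 _) (fun _ _ => rfl), hbA,
        show cohomologyMap (𝟙 (ρ.restrict (subgroupIncl (galFixing F E))).toTopRep) 1 (resH (galFixing F E) ρ 1 a) =
          resH (galFixing F E) ρ 1 a from map_apply_of_id _ (fun _ => rfl) _ (fun _ => rfl) 1 _]
    rw [hcup, show ∀ z, cohomologyMap (𝟙 ((mu F n).restrict (subgroupIncl (galFixing F E))).toTopRep) 2 z = z from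
      fun z => map_apply_of_id _ (fun _ => rfl) _ (fun _ => rfl) 2 z]
    -- `c = res a ∪ bA` is `p`-primary with `cor c = a ∪ cor bA` killed by `ι_F`
    have hkc : p ^ k • (resPairing (galFixing F E) ρ (ρ.homRep (mu F n)) (mu F n) (ρ.evalPairing (mu F n))).cupProduct
        (resH (galFixing F E) ρ 1 a) bA = 0 := by
      rw [← LinearMap.smul_apply, ← map_nsmul, ← map_nsmul, hka, map_zero, map_zero, LinearMap.zero_apply]
    have hcor : cor (galFixing F E) (mu F n) 2 ((resPairing (galFixing F E) ρ (ρ.homRep (mu F n)) (mu F n)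
        (ρ.evalPairing (mu F n))).cupProduct (resH (galFixing F E) ρ 1 a) bA) = 0 := by
      rw [cor_cupProduct_resH]
      have h := congrArg (fun φ : _ →+ ZMod n => φ (cor (galFixing F E) (ρ.homRep (mu F n)) 1 bA)) ha
      change ιF ((ρ.evalPairing (mu F n)).cupProduct a (cor (galFixing F E) (ρ.homRep (mu F n)) 1 bA)) = 0 at h
      exact hιF (h.trans (map_zero ιF).symm)
    rw [eq_zero_of_cor_two_mu_eq_zero F E hp.out hpd _ ⟨k, hkc⟩ hcor, map_zero]
  -- (iii) `res a = 0`; (iv) `(Γ : S) a = cor (res a) = 0` and `p^k a = 0`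
  have hresa : resH (galFixing F E) ρ 1 a = 0 := (injective_iff_map_eq_zero _).1 hE _ hres0
  have hidx : (galFixing F E).index • a = 0 := by rw [← cor_resH (galFixing F E) ρ 0 a, hresa, map_zero]
  exact eq_zero_of_nsmul_of_pow_nsmul hp.out hpd hidx hka

end Local

end Literature.NumberTheory.GaloisRepresentations

end
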